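import Summits.BirchSwinnertonDyer.BirchSwinnertonDyer.Theorems.ErratumRoadFiveEulerHalfGenusClassDataFrame
import Summits.BirchSwinnertonDyer.BirchSwinnertonDyer.Theorems.ErratumRoadFiveEulerHalfPOnlyMultPotMultTwinAtFiveGenusKolyvaginPointsRC
import Summits.BirchSwinnertonDyer.BirchSwinnertonDyer.Theorems.ClassRecordThreeCornerAtThreeShimuraFamilyStringent
import Summits.BirchSwinnertonDyer.BirchSwinnertonDyer.Theorems.ClassRecordThreeCornerAtThreeShimuraFamilyTransverse
import Summits.BirchSwinnertonDyer.BirchSwinnertonDyer.Theorems.ClassRecordThreeEulerHalvesAtThreeKolyvaginFamilyRootClass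
import HarnessLib

/-!
# (b2b-κ) LOCAL CONDITIONS per datum of a package family, on a served genus frame — crux 23444, line `genus` v2.0,
# rank-2 stub `stub_genusClassDataSupply : GenusLine.GenusClassDataSupply` (helper, `--supports 23444`)

Ideator seat `bsd-idea-9` g27 (line owner «genus»); cell bsd-stepL.  Companion of `…GenusClassDataFrame` (p731063, the frame
producers) and of imc-p1 g42's `…GenusFamilyPackage` (`exists_familyPackage = ⟨D, hDy, hB4d, hB3d, hA, hP, hsign⟩`): every theorem
below is stated in that PACKAGE CURRENCY — a family `D : (m ∣ n) → JET.KolyvaginFamilyData W K S.ιc m` on the labelled points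
`ys` (`hDy`), its family trace label (`hB4d`) and admissibility (`hA`) — plus the clause binders of `GenusClassDataSupply`
(`k ≥ 1`, `n` square-free on ZHANG–Kolyvagin primes, `k ≤ M(n)`), so that the `∃ κ κℓ`-closer consumes them by name.

WHAT (clause numbering of evidence #40 on 23444).
* §1 `familyReceptacle_of_frameProfile` — the receptacle input `hrec` of corner-3's stringent brick, VERBATIM its shape, for every
  datum of the family at the places `v ∣ p`: from `receptacle_ys_of_frameProfile` (label (a) of the genus identity transported through
  `Θ(δ) = ± ys m`) by `pointGalHom_apply` ∕ `Affine.Point.map_map`.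
* §2 clause (5) `localization_kolyvaginClass_mem_stringentFamily_of_frameProfile` — `loc_v c_k(D m) ∈ 𝒮_v` at `v ∣ p`
  (Jetchev Prop. 4.9♯ at the split multiplicative prime `p`: `ShimuraWalk.localization_kolyvaginClass_familyData_mem_stringentFamily`
  fed §1, `hbad`∕`hmv`∕`hqN` from the frame file, `hq2 = FrameProfile.sp` at `p ≠ q`).
* §3 clause (4) `localization_kolyvaginClass_mem_kummer_of_frameProfile` — `loc_w c_k(D m) ∈ 𝓛^Kum_w` at every place `w` of `K`
  not over a prime of `m`: complex places (`H¹(ℂ, ·) = 0`) ∕ `𝔳 ∋ p` (§2 + `𝒮 ≤ 𝓛^Kum`) ∕ `𝔳 ∌ p` (Gross 6.2 (1) off `p`,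
  `kolyvaginClass_mem_selmerLocalKer_offP_of_frameProfile`), assembled by corner-3's
  `localization_kolyvaginClass_mem_kummerSelmerStructure_of_forall_selmerLocalKer`.
* §4 clause (1) `kolyvaginClass_mem_modifiedSelmerGroup_of_frameProfile` — `c_k(D n) ∈ H_{𝓕(n)}` (= §3 off `n` + corner-3's
  `kolyvaginClass_familyData_mem_transverseKer` at the primes of `n`).
(Clause (6), the `⨅`-transverse reading, is imc-p1 g42's `localization_kolyvaginClass_mem_transverse_of_frameProfile`
(`…GenusFamilyTransverse`); clauses (2)(3)(7) are its `…GenusFamilyPackage` ∕ `…GenusFamilyLocalOrders`.)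

HONEST FRAMING: book-keeping wrappers over landed corner-3 ∕ road-K bricks on the genus frame; no crux, no stub and no summit
statement is proved here; BSD is proved for no curve.  [cite: Jetchev2008, §3.1 (p. 814), §3.3.1–§3.4.1 (p. 816), Prop. 4.9, Cor. 4.8]
[cite: GrossLMS1991, §6 Prop. 6.2 (1)] [cite: GrossZagier1986, III (3.1)]
presearch: in-tree only (the five bricks named above); no new literature.
-/

set_option autoImplicit false
-- D-0017: single-problem summit, so `Summit.BirchSwinnertonDyer.BirchSwinnertonDyer.…` repeats a namespace BY DESIGN.
set_option linter.dupNamespace false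

noncomputable section

namespace Summit.BirchSwinnertonDyer.BirchSwinnertonDyer.Theorems.GenusLine

open scoped Classical

open NumberField IsDedekindDomain Field
open WeierstrassCurve Literature.NumberTheory.EllipticCurves
  Literature.NumberTheory.EllipticCurves.ModularForms
  Literature.NumberTheory.EllipticCurves.KolyvaginCocycle
  Literature.NumberTheory.EllipticCurves.Jetchev2008
  Literature.NumberTheory.GaloisRepresentations
  Literature.NumberTheory.GaloisRepresentations.DiscreteGaloisModule
  Literature.NumberTheory.GaloisCohomology
open Summit.BirchSwinnertonDyer.Rank1Residual Summit.BirchSwinnertonDyer.Rank1Residual.X11b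
  Summit.BirchSwinnertonDyer.Rank1Residual.JET.SelmerVocabulary
open Summit.BirchSwinnertonDyer.BirchSwinnertonDyer.Theorems

variable {K : Type} [Field K] [NumberField K]

/-! ## §1 The receptacle input `hrec` for every datum of a family on `ys`, at the places over `p` -/

/-- **`hrec` for the family** (VERBATIM the receptacle hypothesis of
`ShimuraWalk.localization_kolyvaginClass_familyData_mem_stringentFamily`): on a served genus frame with the `±` identification
`Θ(δ) = ± ys m` at the genuine levels, there is `n' ∈ ℤ` prime to `p` with `n' • (γ y_m)_v ∈ E⁰`-receptacle and
`n' • (γ y_{m/ℓ})_v ∈ E⁰`-receptacle at every `v ∣ p`, for every datum `D m` (`m ∣ n`, `n` square-free on Gross–Kolyvagin primes)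
of a family with `(D m).y = ys m`. [cite: GrossZagier1986, III (3.1)] [cite: Jetchev2008, Cor. 4.8] -/
theorem familyReceptacle_of_frameProfile (W : WeierstrassCurve ℚ) [W.IsElliptic] [W.IsGloballyMinimal]
    (A : WeierstrassCurve ℚ) [A.IsElliptic] [A.IsGloballyMinimal] (p q : ℕ) [Fact p.Prime] [Fact q.Prime]
    (K : Type) [Field K] [NumberField K] (S : GenusHeegnerSettingRC W A p q K) (hprof : FrameProfile W A p q K)
    (hG1 : ∀ (N : ℕ) [NeZero N] (W : WeierstrassCurve ℚ) (K : Type) [Field K] [NumberField K],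
      phi_heegnerPointOfConductor_mem_range_map_ringClassField_birch N W K)
    [∀ j : ℕ, NumberField (ringClassField K S.ιc j)]
    {ys : (m : ℕ) → (W.baseChange (ringClassField K S.ιc m : Type)).toAffine.Point}
    (hid : haveI := S.nz; haveI := S.nf; ∀ (c : ℕ), c ≠ 0 → c.Coprime (S.E'.conductorNorm ℤ) →
      ∀ δ : GenusKolyvaginDatum S.E' K S.ιc S.Dt S.β S.d₁ c,
        genusTransport W S.E' S.D S.C₂ S.hWd K S.ιc δ = ys c ∨ genusTransport W S.E' S.D S.C₂ S.hWd K S.ιc δ = -ys c)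
    {n : ℕ} (hn : Squarefree n)
    (hKol : ∀ ℓ ∈ n.primeFactors, IsKolyvaginPrime (W.conductorNorm ℤ) W K p ℓ)
    (D : (m : ℕ) → m ∣ n → JET.KolyvaginFamilyData W K S.ιc m) (hDy : ∀ (m : ℕ) (hm : m ∣ n), (D m hm).y = ys m) :
    ∃ n' : ℤ, IsCoprime (p : ℤ) n' ∧ ∀ (m : ℕ) (hm : m ∣ n)
      (γ : ringClassField K S.ιc m ≃ₐ[ℚ] ringClassField K S.ιc m) (v : HeightOneSpectrum (𝓞 K)),
      ((p : ℕ) : 𝓞 K) ∈ v.asIdeal →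
        n' • pointsMap (W.baseChange K) (v.adicCompletion K)
            ((D m hm).toGeomPoints (pointGalHom W (ringClassField K S.ιc m) γ (D m hm).y)) ∈
          E0Receptacle (W.baseChange K) v ∧
        ∀ (ℓ : ℕ) (hℓ : ℓ ∈ m.primeFactors)
          (hle : ringClassField K S.ιc (m / ℓ) ≤ ringClassField K S.ιc m),
          n' • pointsMap (W.baseChange K) (v.adicCompletion K)
              ((D m hm).toGeomPoints (pointGalHom W (ringClassField K S.ιc m) γ
                (WeierstrassCurve.Affine.Point.map (W' := W)
                  ((RingClassField.inclusion S.ιc hle).restrictScalars ℚ)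
                  (D (m / ℓ) ((Nat.div_dvd_of_dvd (Nat.dvd_of_mem_primeFactors hℓ)).trans hm)).y))) ∈
            E0Receptacle (W.baseChange K) v := by
  have hn0 : n ≠ 0 := hn.ne_zero
  have hg : ∀ (m : ℕ), m ∣ n → ∀ r ∈ m.primeFactors, IsKolyvaginPrime (W.conductorNorm ℤ) W K p r :=
    fun m hm r hr ↦ hKol r (Nat.primeFactors_mono hm hn0 hr)
  obtain ⟨n', hn'c, hR⟩ := receptacle_ys_of_frameProfile W A p q K S hprof hG1 hid
  refine ⟨n', hn'c, fun m hm γ v hpv ↦ ⟨?_, fun ℓ hℓ hle ↦ ?_⟩⟩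
  · -- level `m`
    rw [hDy m hm, pointGalHom_apply]
    change n' • pointsMap (W.baseChange K) (v.adicCompletion K)
      (Affine.Point.map (W' := W) (D m hm).emb.toRatAlgHom
        (Affine.Point.map (W' := W) (γ : ringClassField K S.ιc m →ₐ[ℚ] ringClassField K S.ιc m) (ys m))) ∈ _
    rw [Affine.Point.map_map]
    exact hR m (hn.squarefree_of_dvd hm) (hg m hm) _ v hpv
  · -- level `m / ℓ` read in `K[m]`
    have hm' : m / ℓ ∣ n := (Nat.div_dvd_of_dvd (Nat.dvd_of_mem_primeFactors hℓ)).trans hm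
    rw [hDy (m / ℓ) hm', pointGalHom_apply]
    change n' • pointsMap (W.baseChange K) (v.adicCompletion K)
      (Affine.Point.map (W' := W) (D m hm).emb.toRatAlgHom
        (Affine.Point.map (W' := W) (γ : ringClassField K S.ιc m →ₐ[ℚ] ringClassField K S.ιc m)
          (Affine.Point.map (W' := W) ((RingClassField.inclusion S.ιc hle).restrictScalars ℚ) (ys (m / ℓ))))) ∈ _
    rw [Affine.Point.map_map, Affine.Point.map_map]
    exact hR (m / ℓ) (hn.squarefree_of_dvd hm') (hg (m / ℓ) hm') _ v hpv

/-! ## §2 Clause (5): stringent at the places over `p` -/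

/-- **Clause (5) of `GenusClassDataSupply` per datum** (Jetchev Prop. 4.9♯ at `v ∣ p`): on a served genus frame, for a family `D` on the
labelled points `ys` with its trace label and admissibility (the package currency), every datum's class `c_k(D m)` (`m ∣ n`, `n` square-free
on Zhang–Kolyvagin primes, `1 ≤ k ≤ M(n)`) localises into the stringent condition at every place `v ∣ p` — `p` is split multiplicative for
`W/ℚ` and split in `K` (`FrameProfile.sp` at `p ≠ q`), the place is bad, `v ∌ m`, and §1 supplies the receptacle.
[cite: Jetchev2008, Prop. 4.9, Cor. 4.8] [cite: GrossZagier1986, III (3.1)] -/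
theorem localization_kolyvaginClass_mem_stringentFamily_of_frameProfile (W : WeierstrassCurve ℚ) [W.IsElliptic]
    [W.IsGloballyMinimal] [NeZero (W.conductorNorm ℤ)]
    (A : WeierstrassCurve ℚ) [A.IsElliptic] [A.IsGloballyMinimal] (p q : ℕ) [Fact p.Prime] [Fact q.Prime]
    (K : Type) [Field K] [NumberField K] (S : GenusHeegnerSettingRC W A p q K) (hprof : FrameProfile W A p q K)
    (hG1 : ∀ (N : ℕ) [NeZero N] (W : WeierstrassCurve ℚ) (K : Type) [Field K] [NumberField K],
      phi_heegnerPointOfConductor_mem_range_map_ringClassField_birch N W K)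
    (DtW : ModularParametrizationData W (W.conductorNorm ℤ)) [∀ j : ℕ, NumberField (ringClassField K S.ιc j)]
    {ys : (m : ℕ) → (W.baseChange (ringClassField K S.ιc m : Type)).toAffine.Point}
    (hid : haveI := S.nz; haveI := S.nf; ∀ (c : ℕ), c ≠ 0 → c.Coprime (S.E'.conductorNorm ℤ) →
      ∀ δ : GenusKolyvaginDatum S.E' K S.ιc S.Dt S.β S.d₁ c,
        genusTransport W S.E' S.D S.C₂ S.hWd K S.ιc δ = ys c ∨ genusTransport W S.E' S.D S.C₂ S.hWd K S.ιc δ = -ys c)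
    {k n : ℕ} (hk : 1 ≤ k) (hN : ((p ^ k : ℕ) : ℤ) ≠ 0) (hn : Squarefree n)
    (hKol : ∀ ℓ ∈ n.primeFactors, Zhang2014.IsKolyvaginPrime (W.conductorNorm ℤ) W K p ℓ)
    (hkn : (k : ℕ∞) ≤ Zhang2014.levelIndex W p n)
    (D : (m : ℕ) → m ∣ n → JET.KolyvaginFamilyData W K S.ιc m) (hDy : ∀ (m : ℕ) (hm : m ∣ n), (D m hm).y = ys m)
    (hB4d : ∀ (m : ℕ) (hm : m ∣ n), ∀ (ℓ : ℕ) (hℓ : ℓ ∈ m.primeFactors)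
      (hle : ringClassField K S.ιc (m / ℓ) ≤ ringClassField K S.ιc m),
      ∑ i ∈ Finset.range (ℓ + 1), pointGalHom W (ringClassField K S.ιc m) ((D m hm).σ ℓ ^ i) (D m hm).y =
        W.frobeniusTrace ℓ • WeierstrassCurve.Affine.Point.map (W' := W)
          ((RingClassField.inclusion S.ιc hle).restrictScalars ℚ)
          (D (m / ℓ) ((Nat.div_dvd_of_dvd (Nat.dvd_of_mem_primeFactors hℓ)).trans hm)).y)
    (hA : ∀ (m : ℕ) (hm : m ∣ n) (M : ℕ), IsAdmissible (absoluteGaloisGroup K) (D m hm).pointsSubgroup ((p ^ M : ℕ) : ℤ))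
    {m : ℕ} (hm : m ∣ n) (v : HeightOneSpectrum (𝓞 K)) (hpv : ((p : ℕ) : 𝓞 K) ∈ v.asIdeal) :
    galoisCohomology.localization ((W.baseChange K).torsionGaloisModule ((p ^ k : ℕ) : ℤ)) (Sum.inr v) 1
        ((D m hm).kolyvaginClass (Fact.out : p.Prime) k) ∈
      JET.stringentFamily W K hN (Sum.inr v) := by
  have hp : p.Prime := Fact.out
  have hK : IsImaginaryQuadratic K := hprof.quad
  have hn0 : n ≠ 0 := hn.ne_zero
  have hm0 : m ≠ 0 := ne_zero_of_dvd_ne_zero hn0 hm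
  -- Gross currency at depth `k`
  have hKolG := gross_of_zhang_level_of_frameProfile W A p q K hprof hKol hk hkn
  have hKol' : ∀ ℓ ∈ n.primeFactors, IsKolyvaginPrime (W.conductorNorm ℤ) W K p ℓ := fun ℓ hℓ ↦ (hKolG ℓ hℓ).1
  -- the place `v ∣ p`: bad, `v ∌ m`, `p ∣ N_W` split in `K`
  have hbad := not_hasGoodReductionAt_of_frameProfile W A p q K hprof v hpv
  have hmv : (m : 𝓞 K) ∉ v.asIdeal :=
    natCast_not_mem_of_frameProfile W A p q K hprof hm0 (fun ℓ hℓ ↦ hKol' ℓ (Nat.primeFactors_mono hm hn0 hℓ)) v hpv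
  have hpN := dvd_conductorNorm_of_frameProfile W A p q K hprof
  have hq2 := hprof.sp p hp hpN hprof.q_ne.symm
  -- the receptacle
  obtain ⟨n', hn'c, hR⟩ := familyReceptacle_of_frameProfile W A p q K S hprof hG1 hid hn hKol' D hDy
  have hcop : IsCoprime ((p ^ k : ℕ) : ℤ) n' := by
    rw [Nat.cast_pow]; exact hn'c.pow_left
  exact ShimuraWalk.localization_kolyvaginClass_familyData_mem_stringentFamily hK S.ιc hp hk hN DtW hn hKolG D hB4d
    (fun m hm ↦ hA m hm k) hm p hpN hq2 v hpv hmv hbad hcop (fun γ ↦ hR m hm γ v hpv)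

/-! ## §3 Clause (4): the Kummer condition at every place not over the level -/

/-- **Clause (4) of `GenusClassDataSupply` per datum** (`loc_w c_k(D m) ∈ H¹_Kum(K_w)` at every place `w` of `K` not over a prime factor
of `m`): complex places carry no condition; at a finite `𝔳 ∋ p` the class is stringent (§2) and `𝒮 ≤ 𝓛^Kum`; at a finite
`𝔳 ∌ p`, `𝔳 ∌ m` it is Gross's Prop. 6.2 (1) off `p` (`kolyvaginClass_mem_selmerLocalKer_offP_of_frameProfile`).
[cite: GrossLMS1991, §6 Prop. 6.2 (1)] [cite: Jetchev2008, §3.3.1 (p. 816), Prop. 4.9] -/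
theorem localization_kolyvaginClass_mem_kummer_of_frameProfile (W : WeierstrassCurve ℚ) [W.IsElliptic]
    [W.IsGloballyMinimal] [NeZero (W.conductorNorm ℤ)]
    (A : WeierstrassCurve ℚ) [A.IsElliptic] [A.IsGloballyMinimal] (p q : ℕ) [Fact p.Prime] [Fact q.Prime]
    (K : Type) [Field K] [NumberField K] (S : GenusHeegnerSettingRC W A p q K) (hprof : FrameProfile W A p q K)
    (hG1 : ∀ (N : ℕ) [NeZero N] (W : WeierstrassCurve ℚ) (K : Type) [Field K] [NumberField K],
      phi_heegnerPointOfConductor_mem_range_map_ringClassField_birch N W K)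
    (DtW : ModularParametrizationData W (W.conductorNorm ℤ)) [∀ j : ℕ, NumberField (ringClassField K S.ιc j)]
    {ys : (m : ℕ) → (W.baseChange (ringClassField K S.ιc m : Type)).toAffine.Point}
    (hid : haveI := S.nz; haveI := S.nf; ∀ (c : ℕ), c ≠ 0 → c.Coprime (S.E'.conductorNorm ℤ) →
      ∀ δ : GenusKolyvaginDatum S.E' K S.ιc S.Dt S.β S.d₁ c,
        genusTransport W S.E' S.D S.C₂ S.hWd K S.ιc δ = ys c ∨ genusTransport W S.E' S.D S.C₂ S.hWd K S.ιc δ = -ys c)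
    {k n : ℕ} (hk : 1 ≤ k) (hN : ((p ^ k : ℕ) : ℤ) ≠ 0) (hn : Squarefree n)
    (hKol : ∀ ℓ ∈ n.primeFactors, Zhang2014.IsKolyvaginPrime (W.conductorNorm ℤ) W K p ℓ)
    (hkn : (k : ℕ∞) ≤ Zhang2014.levelIndex W p n)
    (D : (m : ℕ) → m ∣ n → JET.KolyvaginFamilyData W K S.ιc m) (hDy : ∀ (m : ℕ) (hm : m ∣ n), (D m hm).y = ys m)
    (hB4d : ∀ (m : ℕ) (hm : m ∣ n), ∀ (ℓ : ℕ) (hℓ : ℓ ∈ m.primeFactors)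
      (hle : ringClassField K S.ιc (m / ℓ) ≤ ringClassField K S.ιc m),
      ∑ i ∈ Finset.range (ℓ + 1), pointGalHom W (ringClassField K S.ιc m) ((D m hm).σ ℓ ^ i) (D m hm).y =
        W.frobeniusTrace ℓ • WeierstrassCurve.Affine.Point.map (W' := W)
          ((RingClassField.inclusion S.ιc hle).restrictScalars ℚ)
          (D (m / ℓ) ((Nat.div_dvd_of_dvd (Nat.dvd_of_mem_primeFactors hℓ)).trans hm)).y)
    (hA : ∀ (m : ℕ) (hm : m ∣ n) (M : ℕ), IsAdmissible (absoluteGaloisGroup K) (D m hm).pointsSubgroup ((p ^ M : ℕ) : ℤ))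
    {m : ℕ} (hm : m ∣ n) (w : Place K) (hw : ∀ ℓ ∈ m.primeFactors, ¬ PlaceOver K w ℓ) :
    galoisCohomology.localization ((W.baseChange K).torsionGaloisModule ((p ^ k : ℕ) : ℤ)) w 1
        ((D m hm).kolyvaginClass (Fact.out : p.Prime) k) ∈
      (W.baseChange K).kummerSelmerStructure ((p ^ k : ℕ) : ℤ) w := by
  have hp : p.Prime := Fact.out
  have hK : IsImaginaryQuadratic K := hprof.quad
  have hn0 : n ≠ 0 := hn.ne_zero
  have hm0 : m ≠ 0 := ne_zero_of_dvd_ne_zero hn0 hm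
  have hKolG := gross_of_zhang_level_of_frameProfile W A p q K hprof hKol hk hkn
  have hKolm : ∀ ℓ ∈ m.primeFactors, IsKolyvaginPrime (W.conductorNorm ℤ) W K p ℓ ∧ FrobEqFrobInfty W K (p ^ k) ℓ :=
    fun ℓ hℓ ↦ hKolG ℓ (Nat.primeFactors_mono hm hn0 hℓ)
  refine (D m hm).localization_kolyvaginClass_mem_kummerSelmerStructure_of_forall_selmerLocalKer hK hp k
    (hn.squarefree_of_dvd hm) (fun 𝔳 h𝔳 ↦ ?_) w hw
  by_cases hp𝔳 : ((p : ℕ) : 𝓞 K) ∈ 𝔳.asIdeal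
  · -- `𝔳 ∣ p`: stringent, hence Kummer
    have hstr := localization_kolyvaginClass_mem_stringentFamily_of_frameProfile W A p q K S hprof hG1 DtW hid hk hN
      hn hKol hkn D hDy hB4d hA hm 𝔳 hp𝔳
    have hkum := JET.stringentFamily_le_kummer W K hN (Sum.inr 𝔳) hstr
    rw [← AddSubgroup.mem_comap, (W.baseChange K).comap_localization_kummerSelmerStructure] at hkum
    exact hkum
  · -- `𝔳 ∤ p m`: Gross 6.2 (1)
    exact kolyvaginClass_mem_selmerLocalKer_offP_of_frameProfile W A p q K hprof S.ιc hm0 (fun ℓ hℓ ↦ (hKolm ℓ hℓ).1)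
      (D m hm) k 𝔳 h𝔳 hp𝔳

/-! ## §4 Clause (1): the modified Selmer module at the level -/

/-- **Clause (1) of `GenusClassDataSupply`** (`c_k(D n) ∈ H_{𝓕(n)}`, Jetchev's Selmer module of the Kummer structure modified to the
transverse condition at the primes of `n`): the Kummer condition off `n` is §3; at a prime `ℓ ∣ n` the class is transverse
(`ShimuraWalk.kolyvaginClass_familyData_mem_transverseKer`, Gross depth `k ≤ M(n)` from the Zhang currency, the unit guard `disc K < −4` from
the genus discriminants). [cite: Jetchev2008, §3.1.2 (p. 814), §3.4.1 (p. 816)] [cite: GrossLMS1991, §4] -/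
theorem kolyvaginClass_mem_modifiedSelmerGroup_of_frameProfile (W : WeierstrassCurve ℚ) [W.IsElliptic]
    [W.IsGloballyMinimal] [NeZero (W.conductorNorm ℤ)]
    (A : WeierstrassCurve ℚ) [A.IsElliptic] [A.IsGloballyMinimal] (p q : ℕ) [Fact p.Prime] [Fact q.Prime]
    (K : Type) [Field K] [NumberField K] (S : GenusHeegnerSettingRC W A p q K) (hprof : FrameProfile W A p q K)
    (hG1 : ∀ (N : ℕ) [NeZero N] (W : WeierstrassCurve ℚ) (K : Type) [Field K] [NumberField K],
      phi_heegnerPointOfConductor_mem_range_map_ringClassField_birch N W K)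
    (DtW : ModularParametrizationData W (W.conductorNorm ℤ)) [∀ j : ℕ, NumberField (ringClassField K S.ιc j)]
    {ys : (m : ℕ) → (W.baseChange (ringClassField K S.ιc m : Type)).toAffine.Point}
    (hid : haveI := S.nz; haveI := S.nf; ∀ (c : ℕ), c ≠ 0 → c.Coprime (S.E'.conductorNorm ℤ) →
      ∀ δ : GenusKolyvaginDatum S.E' K S.ιc S.Dt S.β S.d₁ c,
        genusTransport W S.E' S.D S.C₂ S.hWd K S.ιc δ = ys c ∨ genusTransport W S.E' S.D S.C₂ S.hWd K S.ιc δ = -ys c)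
    {k n : ℕ} (hk : 1 ≤ k) (hN : ((p ^ k : ℕ) : ℤ) ≠ 0) (hn : Squarefree n)
    (hKol : ∀ ℓ ∈ n.primeFactors, Zhang2014.IsKolyvaginPrime (W.conductorNorm ℤ) W K p ℓ)
    (hkn : (k : ℕ∞) ≤ Zhang2014.levelIndex W p n)
    (D : (m : ℕ) → m ∣ n → JET.KolyvaginFamilyData W K S.ιc m) (hDy : ∀ (m : ℕ) (hm : m ∣ n), (D m hm).y = ys m)
    (hB4d : ∀ (m : ℕ) (hm : m ∣ n), ∀ (ℓ : ℕ) (hℓ : ℓ ∈ m.primeFactors)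
      (hle : ringClassField K S.ιc (m / ℓ) ≤ ringClassField K S.ιc m),
      ∑ i ∈ Finset.range (ℓ + 1), pointGalHom W (ringClassField K S.ιc m) ((D m hm).σ ℓ ^ i) (D m hm).y =
        W.frobeniusTrace ℓ • WeierstrassCurve.Affine.Point.map (W' := W)
          ((RingClassField.inclusion S.ιc hle).restrictScalars ℚ)
          (D (m / ℓ) ((Nat.div_dvd_of_dvd (Nat.dvd_of_mem_primeFactors hℓ)).trans hm)).y)
    (hA : ∀ (m : ℕ) (hm : m ∣ n) (M : ℕ), IsAdmissible (absoluteGaloisGroup K) (D m hm).pointsSubgroup ((p ^ M : ℕ) : ℤ)) :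
    (D n dvd_rfl).kolyvaginClass (Fact.out : p.Prime) k ∈ modifiedSelmerGroup W K S.ιc ((p ^ k : ℕ) : ℤ) n := by
  have hp : p.Prime := Fact.out
  have hK : IsImaginaryQuadratic K := hprof.quad
  have hp2 : p ≠ 2 := by have := hprof.five_le; omega
  have hD : NumberField.discr K < -4 := GenusKolyvaginRC.discr_lt_neg_four_of_genus hK S.hd₁ S.hd₂ S.hd
  have hKolG := gross_of_zhang_level_of_frameProfile W A p q K hprof hKol hk hkn
  have hKol' : ∀ ℓ ∈ n.primeFactors, IsKolyvaginPrime (W.conductorNorm ℤ) W K p ℓ := fun ℓ hℓ ↦ (hKolG ℓ hℓ).1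
  have hkf : (k : ℕ∞) ≤ ShimuraWalk.frobLevelIndex W K p n :=
    (ShimuraWalk.natCast_le_frobLevelIndex_iff hKol' k).mpr fun ℓ hℓ ↦ (hKolG ℓ hℓ).2
  refine (mem_modifiedSelmerGroup_iff W K S.ιc ((p ^ k : ℕ) : ℤ) n _).mpr ?_
  exact ⟨fun w hw ↦ localization_kolyvaginClass_mem_kummer_of_frameProfile W A p q K S hprof hG1 DtW hid hk hN hn hKol hkn D hDy
      hB4d hA dvd_rfl w hw,
    fun ℓ hℓ ↦ ShimuraWalk.kolyvaginClass_familyData_mem_transverseKer W hK hD hp2 S.ιc k hn hKol' hkf (D n dvd_rfl) hℓ⟩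

end Summit.BirchSwinnertonDyer.BirchSwinnertonDyer.Theorems.GenusLine

end
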